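import Summits.Ventures.HSemireg.SignedPureWeilMinimalDesigns
import Summits.Ventures.HSemireg.SignedPureWeilDesignsN6
import Summits.Ventures.HSemireg.SignedPureWeilAngles

/-!
# Venture HSemireg — THE DYADIC VALUATION OF THE WEIL MOMENT: `(1 + i)^{3n−2} ∣ m̂(+,…,+)` for every pure integer design on (ℤ∕4)ⁿ;
# hence the MASS FLOOR `|Re W| + |Im W| ≥ 2^{⌈(3n−2)∕2⌉}` and the exact SIGN LADDER s±(1..4) = 2, 4, 16, 32, s±(5) ≥ 128, s±(6) ≥ 256

HONEST FRAMING. Part of the Lean index of the computation cell `pub-hsemireg` (Sunday typer seat p9, § g = 8; family B row **B20-3**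
of `target-g8/CENSUS.md`: signed pure-Weil unit-graph designs are «class witnesses — cycles with ℤ-coefficients — not census objects»).
FINITE GAUSSIAN-INTEGER ARITHMETIC ONLY, in the vocabulary of `SignedPureWeilLadder.lean` (`Letter`, `Eps`, `vmoment`, `plus`, `minus`,
`supp`, `sl`, `uTab`, `vTab`, `unitTab`, `four_mul_pair`, `sl_pure`, `rung1..rung4`), `SignedPureWeilMinimalDesigns.lean` (`design14`,
`design28`) and `SignedPureWeilDesignsN6.lean` (`design184`). No abelian variety, cycle, sheaf or semiregularity map is constructed; nothing
here says that HC ∕ HC_CM ∕ HC_AV holds; no object is certified; no Literature fact is declared; no verdict ∕ door word ∕ count of the cell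
moves. Seat record: `HOME/p9/STRUCTURE-DYADIC-p9g10.md` (machine companion: the image {W(m)} is EXACTLY the ideal (1+i)^{3n−2}ℤ[i] for
n ≤ 5, integer Hermite normal form, kit j245117) and `HOME/p9/HANDOFF-p9-g10.md`.

§1–§4 THE THEOREM (`ell_pow_dvd_vmoment_plus`, all n ≥ 1). Write ℓ = 1 + i (`ell`; ℓ² = 2i). If all 3ⁿ − 2 visible moments of an
integer design `m : (ℤ∕4)ⁿ → ℤ` vanish, then **ℓ^{3n−2} ∣ W(m) = m̂(+,…,+)**. PROOF by induction on n: at n = 1 purity is `Σ_x m(x) = 0`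
and `W = m₀ + i·m₁ − m₂ − i·m₃ = ℓ·(i·m₁ − (1−i)·m₂ − m₃)` (`ell_dvd_vmoment_plus_one`); for a pure design on (ℤ∕4)ⁿ⁺¹ (n ≥ 1) the
slice-pair design `sl m a` is pure (`sl_pure`) and the four-point identity `four_mul_pair` at the top frequency reads `4·W(sl m a) =
(1−i)i^{−a}·W(m)`, i.e. **`W(m) = w_a·ℓ³·W(sl m a)`** with a unit `w_a` (`vmoment_plus_eq_ell_cube_mul`) — three powers of ℓ per level.
§5 LEVEL INSTANCES `level4∕5_vmoment_plus` (32 ∣ Re W, Im W at n = 4; 64 ∣ Re W, Im W and 128 ∣ Re W + Im W at n = 5) and FLOORS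
`level4_floor` (W ≠ 0 ⇒ |Re W| ≥ 32 or |Im W| ≥ 32; so a diagonal W ≠ 0 has |Re W| = |Im W| ≥ 32), `level5_axis_floor`
(real W ≠ 0 ⇒ |W| ≥ 128 — `design80` of `SignedPureWeilFourierCertificate.lean`, W = −128, sits on it). §6 SHARPNESS (`sharpness`): `rung1`
(W = 1 − i), `rung2` (4), `design14` (8 + 8i), `design28` (−32), `design184` (256) have N(W) = 2^{3n−2} exactly, n = 1, 2, 3, 4, 6; at n = 5
the ideal is attained by machine only (`design80` gives ℓ¹⁴). §7 MASS: `weil_gmass_floor` — **|Re W| + |Im W| ≥ 2^{⌈(3n−2)∕2⌉}** for every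
pure W-alive design (two powers of ℓ double the mass, `gmass_floor_of_ell_pow_dvd`); `gmass_vmoment_le_l1` — |Re W| + |Im W| ≤ Σ_x |m(x)|
(termwise); hence **`l1_floor`: Σ_x |m(x)| ≥ 2^{⌈(3n−2)∕2⌉}** (32 at n = 4, attained by `design28`; 128 at n = 5, attained by `design80`;
256 at n = 6) and **`sign_design_floor`: a pure W-alive design with values in {0, ±1} has ≥ 2^{⌈(3n−2)∕2⌉} letters** — with the sign
rungs of `SignedPureWeilLadder.lean` this is EXACT for n ≤ 4 (`sign_ladder_exact`: s±(1..4) = 2, 4, 16, 32) and gives s±(5) ≥ 128,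
s±(6) ≥ 256 (`sign_design_floor_5_6`; the tensor trick on sign rungs attains both — not restated here); more generally
**`coeff_bounded_floor`: |m| ≤ C everywhere ⇒ C·#supp ≥ 2^{⌈(3n−2)∕2⌉}**, e.g. **`s5_ge_64_of_coeff_le_two`: a pure W-alive design on (ℤ∕4)⁵
with values in {0, ±1, ±2} has ≥ 64 letters, census-free** (48 is the kernel bound of record for arbitrary coefficients). So the coefficient 2
is exactly what buys the integer designs of record their 14 < 16, 28 < 32, 80 < 128 and 184 < 256 letters.

REMARK (machine pattern, not a theorem here). For DIAGONAL W the mass floor is 2^{⌊(3n−2)∕2⌋+1}: twice the axis floor at even n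
(n = 4: 64 vs 32; `diag37` of `SignedPureWeilDiagonalDesign37.lean`, W = 32 + 32i, mass 64, sits on it), equal to it at odd n (16 at n = 3,
128 at n = 5) — the same parity alternation as the machine class minima s_axis(2) = 4 < s_diag(2) = 6, s_axis(3) = s_diag(3) = 14, s_axis(4) = 28 < s_diag(4).

WHAT IS NOT HERE. A kernel witness for the ideal at n = 5; any bound on the supports of INTEGER designs beyond `l1_floor` (the theorem
constrains values, not letters); anything about sheaves or semiregularity.
-/

namespace Summit.Ventures.HSemireg.SignedWeilDesignN

open Finset

variable {n : ℕ}

/-! ## §1 ℓ = 1 + i and the unit tables -/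

/-- `ℓ = 1 + i`, the ramified prime of ℤ[i] (`ℓ² = 2i`). [definition of this file] -/
def ell : GaussianInt := ⟨1, 1⟩

/-- The units `w_a` with `2·(1+i)i^{a} = w_a·ℓ³`, tabulated: `−i, 1, i, −1`. [definition of this file] -/
def wTab : Fin 4 → GaussianInt := ![⟨0, -1⟩, 1, ⟨0, 1⟩, -1]

/-- `2·vTab a = w_a·ℓ³`. -/
theorem two_mul_vTab_eq : ∀ a : Fin 4, 2 * vTab a = wTab a * ell ^ 3 := by decide

/-- `vTab a · uTab a = 2` (`(1+i)i^{a}·(1−i)i^{−a} = 2`). -/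
theorem vTab_mul_uTab : ∀ a : Fin 4, vTab a * uTab a = 2 := by decide

/-- The norm of `ℓ^k` is `2^k`. -/
theorem norm_ell_pow (k : ℕ) : (ell ^ k).norm = 2 ^ k := by
  induction k with
  | zero => decide
  | succ k ih => rw [pow_succ, Zsqrtd.norm_mul, ih, pow_succ]; rfl

/-! ## §2 The slice identity at the top frequency: `W(m) = w_a·ℓ³·W(sl m a)` (from `four_mul_vmoment_sl_plus` of `SignedPureWeilAngles.lean`) -/

/-- **`W(m) = w_a·ℓ³·W(sl m a)`** for a pure design on (ℤ∕4)ⁿ⁺¹ (n ≥ 1) and every `a`. -/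
theorem vmoment_plus_eq_ell_cube_mul (hn : 0 < n) (m : Letter (n + 1) → ℤ)
    (hpure : ∀ ε : Eps (n + 1), ε ≠ plus → ε ≠ minus → vmoment m ε = 0) (a : Fin 4) :
    vmoment m plus = wTab a * ell ^ 3 * vmoment (sl m a) plus := by
  have h := four_mul_vmoment_sl_plus hn m hpure a
  have h2 : (2 : GaussianInt) * vmoment m plus = 2 * (wTab a * ell ^ 3 * vmoment (sl m a) plus) := by
    calc (2 : GaussianInt) * vmoment m plus = vTab a * uTab a * vmoment m plus := by rw [vTab_mul_uTab]
      _ = vTab a * (4 * vmoment (sl m a) plus) := by rw [h]; ring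
      _ = 2 * vTab a * vmoment (sl m a) plus * 2 := by ring
      _ = wTab a * ell ^ 3 * vmoment (sl m a) plus * 2 := by rw [two_mul_vTab_eq]
      _ = 2 * (wTab a * ell ^ 3 * vmoment (sl m a) plus) := by ring
  exact mul_left_cancel₀ (by decide) h2

/-! ## §3 The base case n = 1 -/

/-- A sum over the four one-letter words. -/
theorem sum_letter_one {R : Type*} [AddCommMonoid R] (f : Letter 1 → R) :
    (∑ x, f x) = f (fun _ => 0) + f (fun _ => 1) + f (fun _ => 2) + f (fun _ => 3) := by
  rw [← Equiv.sum_comp (Equiv.funUnique (Fin 1) (Fin 4)).symm f, Fin.sum_univ_four]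
  rfl

/-- **n = 1:** if `Σ_x m(x) = 0` (the only visible moment) then `ℓ ∣ m̂(+) = m₀ + i·m₁ − m₂ − i·m₃`. -/
theorem ell_dvd_vmoment_plus_one (m : Letter 1 → ℤ)
    (hpure : ∀ ε : Eps 1, ε ≠ plus → ε ≠ minus → vmoment m ε = 0) : ell ∣ vmoment m plus := by
  have hz : vmoment m (fun _ => 0) = 0 := by
    refine hpure _ ?_ ?_
    · intro h; have := congrFun h 0; simp [plus] at this
    · intro h; have := congrFun h 0; simp [minus] at this
  have e0 : vmoment m (fun _ => 0) =
      (m (fun _ => 0) : GaussianInt) + m (fun _ => 1) + m (fun _ => 2) + m (fun _ => 3) := by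
    unfold vmoment; rw [sum_letter_one]; simp [vchi, expo, coef, unitTab]
  have e1 : vmoment m plus =
      (m (fun _ => 0) : GaussianInt) * 1 + m (fun _ => 1) * ⟨0, 1⟩ + m (fun _ => 2) * (-1) + m (fun _ => 3) * (-⟨0, 1⟩) := by
    unfold vmoment; rw [sum_letter_one]; simp [vchi, expo, coef, unitTab, plus]
  rw [e0] at hz
  have hm0 : (m (fun _ => 0) : GaussianInt) = -(m (fun _ => 1) : GaussianInt) - m (fun _ => 2) - m (fun _ => 3) := by
    linear_combination hz
  refine ⟨⟨0, 1⟩ * m (fun _ => 1) + ⟨-1, 1⟩ * m (fun _ => 2) + (-1) * m (fun _ => 3), ?_⟩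
  rw [e1, hm0]
  simp only [ell]
  ext
  · simp; ring
  · simp

/-! ## §4 The theorem -/

/-- **THE DYADIC VALUATION OF THE WEIL MOMENT: `ℓ^{3n−2} ∣ m̂(+,…,+)` for every pure integer design on (ℤ∕4)ⁿ, n ≥ 1.** -/
theorem ell_pow_dvd_vmoment_plus : ∀ (n : ℕ), 0 < n → ∀ (m : Letter n → ℤ),
    (∀ ε : Eps n, ε ≠ plus → ε ≠ minus → vmoment m ε = 0) → ell ^ (3 * n - 2) ∣ vmoment m plus := by
  intro n hn
  induction n with
  | zero => exact absurd hn (lt_irrefl 0)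
  | succ k ih =>
    intro m hpure
    rcases Nat.eq_zero_or_pos k with hk | hk
    · subst hk
      simpa using ell_dvd_vmoment_plus_one m hpure
    · have hsl : ell ^ (3 * k - 2) ∣ vmoment (sl m 0) plus := ih hk (sl m 0) (sl_pure m hpure 0)
      rw [vmoment_plus_eq_ell_cube_mul hk m hpure 0]
      have e : 3 * (k + 1) - 2 = 3 + (3 * k - 2) := by omega
      rw [e, pow_add]
      exact mul_dvd_mul (Dvd.intro_left _ rfl) hsl

/-! ## §5 Level instances and floors -/

/-- Level 4: `32 ∣ W` in ℤ[i] — **both parts of the Weil moment of a pure design on (ℤ∕4)⁴ are multiples of 32**. -/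
theorem level4_vmoment_plus (m : Letter 4 → ℤ) (hpure : ∀ ε : Eps 4, ε ≠ plus → ε ≠ minus → vmoment m ε = 0) :
    (32 : ℤ) ∣ (vmoment m plus).re ∧ (32 : ℤ) ∣ (vmoment m plus).im := by
  have h := ell_pow_dvd_vmoment_plus 4 (by norm_num) m hpure
  have e : ell ^ (3 * 4 - 2) = (32 : GaussianInt) * ⟨0, 1⟩ := by decide
  rw [e] at h
  have h32 : ((32 : ℤ) : GaussianInt) ∣ vmoment m plus := dvd_trans (Dvd.intro _ rfl) h
  exact (Zsqrtd.intCast_dvd 32 _).mp h32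

/-- Level 5: `64ℓ ∣ W` — **both parts are multiples of 64 and their sum is a multiple of 128**. -/
theorem level5_vmoment_plus (m : Letter 5 → ℤ) (hpure : ∀ ε : Eps 5, ε ≠ plus → ε ≠ minus → vmoment m ε = 0) :
    (64 : ℤ) ∣ (vmoment m plus).re ∧ (64 : ℤ) ∣ (vmoment m plus).im ∧ (128 : ℤ) ∣ (vmoment m plus).re + (vmoment m plus).im := by
  have h := ell_pow_dvd_vmoment_plus 5 (by norm_num) m hpure
  have e : ell ^ (3 * 5 - 2) = (64 * ell) * (-1) := by decide
  rw [e] at h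
  obtain ⟨q, hq⟩ : 64 * ell ∣ vmoment m plus := dvd_trans (Dvd.intro _ rfl) h
  have hre : (vmoment m plus).re = 64 * (q.re - q.im) := by rw [hq]; simp [ell, Zsqrtd.re_mul]; ring
  have him : (vmoment m plus).im = 64 * (q.re + q.im) := by rw [hq]; simp [ell, Zsqrtd.im_mul]; ring
  refine ⟨⟨q.re - q.im, hre⟩, ⟨q.re + q.im, him⟩, ⟨q.re, ?_⟩⟩
  rw [hre, him]; ring

/-- **LEVEL-4 FLOOR:** a pure design on (ℤ∕4)⁴ with nonzero Weil moment has `|Re W| ≥ 32` or `|Im W| ≥ 32` (attained on the axis by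
`design28`, W = −32). -/
theorem level4_floor (m : Letter 4 → ℤ) (hpure : ∀ ε : Eps 4, ε ≠ plus → ε ≠ minus → vmoment m ε = 0)
    (hne : vmoment m plus ≠ 0) :
    32 ≤ |(vmoment m plus).re| ∨ 32 ≤ |(vmoment m plus).im| := by
  obtain ⟨⟨a, ha⟩, ⟨b, hb⟩⟩ := level4_vmoment_plus m hpure
  have hne' : (vmoment m plus).re ≠ 0 ∨ (vmoment m plus).im ≠ 0 :=
    not_and_or.mp (fun hc => hne (Zsqrtd.ext hc.1 hc.2))
  rcases hne' with h | h
  · left; rw [ha] at h ⊢; rw [abs_mul]; have : a ≠ 0 := by rintro rfl; simp at h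
    have : 1 ≤ |a| := Int.one_le_abs this; nlinarith [abs_nonneg a, show |(32:ℤ)| = 32 by norm_num]
  · right; rw [hb] at h ⊢; rw [abs_mul]; have : b ≠ 0 := by rintro rfl; simp at h
    have : 1 ≤ |b| := Int.one_le_abs this; nlinarith [abs_nonneg b, show |(32:ℤ)| = 32 by norm_num]

/-- **LEVEL-5 AXIS FLOOR:** a pure design on (ℤ∕4)⁵ with nonzero REAL Weil moment has `|W| ≥ 128` — attained by `design80`
(`SignedPureWeilFourierCertificate.lean`, W = −128): the 80-letter design of record sits exactly on the dyadic floor. -/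
theorem level5_axis_floor (m : Letter 5 → ℤ) (hpure : ∀ ε : Eps 5, ε ≠ plus → ε ≠ minus → vmoment m ε = 0)
    (hreal : (vmoment m plus).im = 0) (hne : vmoment m plus ≠ 0) : 128 ≤ |(vmoment m plus).re| := by
  obtain ⟨⟨a, ha⟩, ⟨b, hb⟩, ⟨c, hc⟩⟩ := level5_vmoment_plus m hpure
  have hre : (vmoment m plus).re ≠ 0 := by
    intro h0; exact hne (Zsqrtd.ext h0 hreal)
  rw [hreal, add_zero] at hc
  rw [hc] at hre ⊢; rw [abs_mul]
  have : c ≠ 0 := by rintro rfl; simp at hre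
  have : 1 ≤ |c| := Int.one_le_abs this
  nlinarith [abs_nonneg c, show |(128:ℤ)| = 128 by norm_num]

/-! ## §6 Sharpness at n = 1, 2, 3, 4, 6 -/

/-- The Weil moments of the five witnesses: `rung1 ↦ 1 − i`, `rung2 ↦ 4`, `design14 ↦ 8 + 8i`, `design28 ↦ −32`, `design184 ↦ 256`. -/
theorem witness_moments :
    vmoment rung1 plus = ⟨1, -1⟩ ∧ vmoment rung2 plus = 4 ∧ vmoment design14 plus = ⟨8, 8⟩ ∧ vmoment design28 plus = -32 ∧
      vmoment design184 plus = 256 :=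
  ⟨by decide +kernel, by decide +kernel, design14_certificate.2.1, design28_certificate.2.1, design184_certificate.2.1⟩

/-- If `ℓ^k ∣ z` then `2^k ∣ N(z)`. -/
theorem two_pow_dvd_norm_of_ell_pow_dvd {z : GaussianInt} {k : ℕ} (h : ell ^ k ∣ z) : (2 : ℤ) ^ k ∣ z.norm := by
  obtain ⟨q, hq⟩ := h
  rw [hq, Zsqrtd.norm_mul, norm_ell_pow]
  exact Dvd.intro _ rfl

/-- **SHARPNESS:** `ℓ^{3n−1}` does NOT divide the Weil moment of `rung1` (n = 1), `rung2` (n = 2), `design14` (n = 3), `design28` (n = 4),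
`design184` (n = 6) — each has N(W) = 2^{3n−2} exactly. (At n = 5 the ideal ℓ¹³ℤ[i] is attained by machine only; `design80` gives ℓ¹⁴.) -/
theorem sharpness :
    ¬ ell ^ 2 ∣ vmoment rung1 plus ∧ ¬ ell ^ 5 ∣ vmoment rung2 plus ∧ ¬ ell ^ 8 ∣ vmoment design14 plus ∧
      ¬ ell ^ 11 ∣ vmoment design28 plus ∧ ¬ ell ^ 17 ∣ vmoment design184 plus := by
  obtain ⟨h1, h2, h3, h4, h6⟩ := witness_moments
  refine ⟨fun h => ?_, fun h => ?_, fun h => ?_, fun h => ?_, fun h => ?_⟩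
  · have := two_pow_dvd_norm_of_ell_pow_dvd h; rw [h1] at this; revert this; decide
  · have := two_pow_dvd_norm_of_ell_pow_dvd h; rw [h2] at this; revert this; decide
  · have := two_pow_dvd_norm_of_ell_pow_dvd h; rw [h3] at this; revert this; decide
  · have := two_pow_dvd_norm_of_ell_pow_dvd h; rw [h4] at this; revert this; decide
  · have := two_pow_dvd_norm_of_ell_pow_dvd h; rw [h6] at this; revert this; decide

/-! ## §7 Mass floors and SIGN designs (values in {0, ±1}): at least 2^{⌈(3n−2)∕2⌉} letters, exact for n ≤ 4 -/

/-- `|Re z| + |Im z|`, the ℓ¹-size of a Gaussian integer. [definition of this file] -/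
def gmass (z : GaussianInt) : ℤ := |z.re| + |z.im|

/-- `gmass (ℓ²·z) = 2·gmass z` (ℓ² = 2i). -/
theorem gmass_ell_sq_mul (z : GaussianInt) : gmass (ell ^ 2 * z) = 2 * gmass z := by
  rw [show ell ^ 2 = (⟨0, 2⟩ : GaussianInt) by decide]
  simp only [gmass, Zsqrtd.re_mul, Zsqrtd.im_mul]
  rw [show (0 : ℤ) * z.re + -1 * 2 * z.im = -(2 * z.im) by ring, show (0 : ℤ) * z.im + 2 * z.re = 2 * z.re by ring,
    abs_neg, abs_mul, abs_mul, abs_two]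
  ring

/-- A nonzero Gaussian integer has `gmass ≥ 1`. -/
theorem one_le_gmass_of_ne_zero {z : GaussianInt} (hz : z ≠ 0) : 1 ≤ gmass z := by
  unfold gmass
  rcases (not_and_or.mp (fun h => hz (Zsqrtd.ext h.1 h.2)) : z.re ≠ 0 ∨ z.im ≠ 0) with h | h
  · have := Int.one_le_abs h; have := abs_nonneg z.im; omega
  · have := Int.one_le_abs h; have := abs_nonneg z.re; omega

/-- A nonzero multiple of ℓ has `gmass ≥ 2` (`ℓ·(a + bi) = (a − b) + (a + b)i`). -/
theorem two_le_gmass_of_ell_dvd {z : GaussianInt} (h : ell ∣ z) (hz : z ≠ 0) : 2 ≤ gmass z := by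
  obtain ⟨q, rfl⟩ := h
  have hq : q ≠ 0 := by rintro rfl; exact hz (mul_zero _)
  have hq' : q.re ≠ 0 ∨ q.im ≠ 0 := not_and_or.mp (fun h => hq (Zsqrtd.ext h.1 h.2))
  have hre : (ell * q).re = q.re - q.im := by simp [ell, Zsqrtd.re_mul, sub_eq_add_neg]
  have him : (ell * q).im = q.re + q.im := by simp [ell, Zsqrtd.im_mul]; ring
  unfold gmass; rw [hre, him]
  have h1 : |2 * q.re| ≤ |q.re - q.im| + |q.re + q.im| := by
    have := abs_add_le (q.re - q.im) (q.re + q.im)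
    rwa [show q.re - q.im + (q.re + q.im) = 2 * q.re by ring] at this
  have h2 : |2 * q.im| ≤ |q.re - q.im| + |q.re + q.im| := by
    have := abs_add_le (-(q.re - q.im)) (q.re + q.im)
    rwa [show -(q.re - q.im) + (q.re + q.im) = 2 * q.im by ring, abs_neg] at this
  rw [abs_mul, abs_two] at h1 h2
  rcases hq' with h | h
  · have := Int.one_le_abs h; omega
  · have := Int.one_le_abs h; omega

/-- **`ℓ^k ∣ z ≠ 0 ⇒ gmass z ≥ 2^{⌈k∕2⌉}`** (two powers of ℓ double the mass exactly; one power at least doubles 1). -/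
theorem gmass_floor_of_ell_pow_dvd : ∀ (k : ℕ) (z : GaussianInt), ell ^ k ∣ z → z ≠ 0 → (2 : ℤ) ^ ((k + 1) / 2) ≤ gmass z
  | 0, z, _, hz => by simpa using one_le_gmass_of_ne_zero hz
  | 1, z, h, hz => by simpa using two_le_gmass_of_ell_dvd (by simpa using h) hz
  | (k + 2), z, h, hz => by
      obtain ⟨q, rfl⟩ := h
      have hq : q ≠ 0 := by rintro rfl; exact hz (mul_zero _)
      have ih := gmass_floor_of_ell_pow_dvd k (ell ^ k * q) (Dvd.intro _ rfl) (mul_ne_zero (pow_ne_zero _ (by decide)) hq)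
      rw [show ell ^ (k + 2) * q = ell ^ 2 * (ell ^ k * q) by ring, gmass_ell_sq_mul,
        show (k + 2 + 1) / 2 = (k + 1) / 2 + 1 by omega, pow_succ]
      omega

/-- **THE MASS FLOOR OF THE WEIL MOMENT: `|Re W| + |Im W| ≥ 2^{⌈(3n−2)∕2⌉}`** for every pure W-alive integer design on (ℤ∕4)ⁿ
(`(3n − 1) ∕ 2` in natural-number division is `⌈(3n−2)∕2⌉`: 1, 2, 4, 5, 7, 8, 10, … for n = 1, 2, 3, …). -/
theorem weil_gmass_floor (hn : 0 < n) (m : Letter n → ℤ)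
    (hpure : ∀ ε : Eps n, ε ≠ plus → ε ≠ minus → vmoment m ε = 0) (halive : vmoment m plus ≠ 0) :
    (2 : ℤ) ^ ((3 * n - 1) / 2) ≤ gmass (vmoment m plus) := by
  have h := gmass_floor_of_ell_pow_dvd (3 * n - 2) _ (ell_pow_dvd_vmoment_plus n hn m hpure) halive
  rwa [show (3 * n - 2 + 1) / 2 = (3 * n - 1) / 2 by omega] at h

/-- Real part of a finite sum of Gaussian integers. -/
theorem re_finset_sum {ι : Type*} (s : Finset ι) (f : ι → GaussianInt) : (∑ i ∈ s, f i).re = ∑ i ∈ s, (f i).re := by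
  induction s using Finset.cons_induction with
  | empty => simp
  | cons a s ha ih => rw [Finset.sum_cons, Finset.sum_cons, Zsqrtd.re_add, ih]

/-- Imaginary part of a finite sum of Gaussian integers. -/
theorem im_finset_sum {ι : Type*} (s : Finset ι) (f : ι → GaussianInt) : (∑ i ∈ s, f i).im = ∑ i ∈ s, (f i).im := by
  induction s using Finset.cons_induction with
  | empty => simp
  | cons a s ha ih => rw [Finset.sum_cons, Finset.sum_cons, Zsqrtd.im_add, ih]

/-- **`|Re m̂(ε)| + |Im m̂(ε)| ≤ Σ_x |m(x)|`** for every moment of an integer design (termwise triangle inequality). -/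
theorem gmass_vmoment_le_l1 (m : Letter n → ℤ) (ε : Eps n) : gmass (vmoment m ε) ≤ ∑ x, |m x| := by
  unfold gmass vmoment
  rw [re_finset_sum, im_finset_sum]
  calc |∑ x, ((m x : GaussianInt) * vchi ε x).re| + |∑ x, ((m x : GaussianInt) * vchi ε x).im|
      ≤ (∑ x, |((m x : GaussianInt) * vchi ε x).re|) + ∑ x, |((m x : GaussianInt) * vchi ε x).im| :=
        add_le_add (Finset.abs_sum_le_sum_abs _ _) (Finset.abs_sum_le_sum_abs _ _)
    _ = ∑ x, (|((m x : GaussianInt) * vchi ε x).re| + |((m x : GaussianInt) * vchi ε x).im|) :=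
        Finset.sum_add_distrib.symm
    _ = ∑ x, |m x| := Finset.sum_congr rfl (fun x _ => by
        rw [Zsqrtd.re_smul, Zsqrtd.im_smul, abs_mul, abs_mul, ← mul_add]
        unfold vchi
        rw [(by decide : ∀ k : Fin 4, |(unitTab k).re| + |(unitTab k).im| = 1), mul_one])

/-- **THE ℓ¹ FLOOR FOR INTEGER DESIGNS: `Σ_x |m(x)| ≥ 2^{⌈(3n−2)∕2⌉}`** — 32 at n = 4 (attained by `design28`), 128 at n = 5 (attained by
`design80`), 256 at n = 6. A design with fewer letters than the floor must use coefficients of absolute value ≥ 2. -/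
theorem l1_floor (hn : 0 < n) (m : Letter n → ℤ)
    (hpure : ∀ ε : Eps n, ε ≠ plus → ε ≠ minus → vmoment m ε = 0) (halive : vmoment m plus ≠ 0) :
    (2 : ℤ) ^ ((3 * n - 1) / 2) ≤ ∑ x, |m x| :=
  (weil_gmass_floor hn m hpure halive).trans (gmass_vmoment_le_l1 m plus)

/-- **COEFFICIENT-BOUNDED FLOOR:** if `|m(x)| ≤ C` everywhere then `C·#supp m ≥ 2^{⌈(3n−2)∕2⌉}`. -/
theorem coeff_bounded_floor (hn : 0 < n) (m : Letter n → ℤ) (C : ℤ)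
    (hpure : ∀ ε : Eps n, ε ≠ plus → ε ≠ minus → vmoment m ε = 0) (halive : vmoment m plus ≠ 0) (hC : ∀ x, |m x| ≤ C) :
    (2 : ℤ) ^ ((3 * n - 1) / 2) ≤ C * (supp m).card := by
  refine (l1_floor hn m hpure halive).trans ?_
  rw [← Finset.sum_subset (Finset.subset_univ (supp m)) (fun x _ hx => by
        have : m x = 0 := by
          by_contra hne
          exact hx (Finset.mem_filter.mpr ⟨Finset.mem_univ _, hne⟩)
        simp [this])]
  calc ∑ x ∈ supp m, |m x| ≤ ∑ x ∈ supp m, C := Finset.sum_le_sum (fun x _ => hC x)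
    _ = C * (supp m).card := by rw [Finset.sum_const, nsmul_eq_mul, mul_comm]

/-- **SIGN-DESIGN FLOOR (all n): a pure W-alive design on (ℤ∕4)ⁿ with values in {0, ±1} has at least `2^{⌈(3n−2)∕2⌉}` letters.** -/
theorem sign_design_floor (hn : 0 < n) (m : Letter n → ℤ)
    (hpure : ∀ ε : Eps n, ε ≠ plus → ε ≠ minus → vmoment m ε = 0) (halive : vmoment m plus ≠ 0)
    (hs : ∀ x, m x = 0 ∨ m x = 1 ∨ m x = -1) : (2 : ℤ) ^ ((3 * n - 1) / 2) ≤ (supp m).card := by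
  have h := coeff_bounded_floor hn m 1 hpure halive (fun x => by rcases hs x with h | h | h <;> simp [h])
  rwa [one_mul] at h

/-- **CENSUS-FREE: a pure W-alive design on (ℤ∕4)⁵ with values in {0, ±1, ±2} has at least 64 letters** (the kernel bound of record for
arbitrary integer coefficients is 48, `SignedPureWeilAxisLevel2.lean`; 64 needs the census hypothesis AXIS31, `SignedPureWeilAxis31.lean`). -/
theorem s5_ge_64_of_coeff_le_two (m : Letter 5 → ℤ)
    (hpure : ∀ ε : Eps 5, ε ≠ plus → ε ≠ minus → vmoment m ε = 0) (halive : vmoment m plus ≠ 0) (h2 : ∀ x, |m x| ≤ 2) :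
    64 ≤ (supp m).card := by
  have h := coeff_bounded_floor (n := 5) (by norm_num) m 2 hpure halive h2
  norm_num at h
  omega

/-- **THE SIGN LADDER IS EXACT AT n = 1, 2, 3, 4: s±(1) = 2, s±(2) = 4, s±(3) = 16, s±(4) = 32** — the floors 2^{⌈(3n−2)∕2⌉} are attained by
`rung1`, `rung2`, `rung3`, `rung4` of `SignedPureWeilLadder.lean` (all with values ±1). So at n = 3 and n = 4 the coefficient 2 is what buys
the minimal integer designs their 14 < 16 and 28 < 32 letters. -/
theorem sign_ladder_exact :
    ((∀ m : Letter 1 → ℤ, (∀ ε : Eps 1, ε ≠ plus → ε ≠ minus → vmoment m ε = 0) →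
        vmoment m plus ≠ 0 → (∀ x, m x = 0 ∨ m x = 1 ∨ m x = -1) → 2 ≤ (supp m).card) ∧
      (∀ x, rung1 x = 0 ∨ rung1 x = 1 ∨ rung1 x = -1) ∧ (supp rung1).card = 2) ∧
    ((∀ m : Letter 2 → ℤ, (∀ ε : Eps 2, ε ≠ plus → ε ≠ minus → vmoment m ε = 0) →
        vmoment m plus ≠ 0 → (∀ x, m x = 0 ∨ m x = 1 ∨ m x = -1) → 4 ≤ (supp m).card) ∧
      (∀ x, rung2 x = 0 ∨ rung2 x = 1 ∨ rung2 x = -1) ∧ (supp rung2).card = 4) ∧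
    ((∀ m : Letter 3 → ℤ, (∀ ε : Eps 3, ε ≠ plus → ε ≠ minus → vmoment m ε = 0) →
        vmoment m plus ≠ 0 → (∀ x, m x = 0 ∨ m x = 1 ∨ m x = -1) → 16 ≤ (supp m).card) ∧
      (∀ x, rung3 x = 0 ∨ rung3 x = 1 ∨ rung3 x = -1) ∧ (supp rung3).card = 16) ∧
    ((∀ m : Letter 4 → ℤ, (∀ ε : Eps 4, ε ≠ plus → ε ≠ minus → vmoment m ε = 0) →
        vmoment m plus ≠ 0 → (∀ x, m x = 0 ∨ m x = 1 ∨ m x = -1) → 32 ≤ (supp m).card) ∧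
      (∀ x, rung4 x = 0 ∨ rung4 x = 1 ∨ rung4 x = -1) ∧ (supp rung4).card = 32) := by
  refine ⟨⟨fun m hp ha hs => ?_, by decide, rungs_certificate.1.2.2⟩, ⟨fun m hp ha hs => ?_, by decide, rungs_certificate.2.1.2.2⟩,
    ⟨fun m hp ha hs => ?_, by decide, rungs_certificate.2.2.2.2⟩, ⟨fun m hp ha hs => ?_, by decide +kernel, rung4_certificate.2.2⟩⟩
  · have h := sign_design_floor (n := 1) (by norm_num) m hp ha hs; norm_num at h; exact_mod_cast h
  · have h := sign_design_floor (n := 2) (by norm_num) m hp ha hs; norm_num at h; exact_mod_cast h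
  · have h := sign_design_floor (n := 3) (by norm_num) m hp ha hs; norm_num at h; exact_mod_cast h
  · have h := sign_design_floor (n := 4) (by norm_num) m hp ha hs; norm_num at h; exact_mod_cast h

/-- **SIGN DESIGNS AT n = 5 AND n = 6 NEED ≥ 128 AND ≥ 256 LETTERS** (integer designs of record: 80 and 184). The matching upper bounds
128 = 2·2·32 and 256 = 2·4·32 follow from the tensor trick (`tensor_trick` of `SignedPureWeilTransport.lean`) applied to the sign rungs; they
are not restated here. -/
theorem sign_design_floor_5_6 :
    (∀ m : Letter 5 → ℤ, (∀ ε : Eps 5, ε ≠ plus → ε ≠ minus → vmoment m ε = 0) →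
        vmoment m plus ≠ 0 → (∀ x, m x = 0 ∨ m x = 1 ∨ m x = -1) → 128 ≤ (supp m).card) ∧
    (∀ m : Letter 6 → ℤ, (∀ ε : Eps 6, ε ≠ plus → ε ≠ minus → vmoment m ε = 0) →
        vmoment m plus ≠ 0 → (∀ x, m x = 0 ∨ m x = 1 ∨ m x = -1) → 256 ≤ (supp m).card) := by
  refine ⟨fun m hp ha hs => ?_, fun m hp ha hs => ?_⟩
  · have h := sign_design_floor (n := 5) (by norm_num) m hp ha hs; norm_num at h; exact_mod_cast h
  · have h := sign_design_floor (n := 6) (by norm_num) m hp ha hs; norm_num at h; exact_mod_cast h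

end Summit.Ventures.HSemireg.SignedWeilDesignN
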